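import Literature.Computability.AlgebraicComplexity.BLMW11StabilityInheritance
import Literature.NumberTheory.DiophantineGeometry.SymmetricGroupRepsKroneckerSymmetryProofs
import Literature.NumberTheory.DiophantineGeometry.WeylModuleOneRowForms
import Literature.RepresentationTheory.FiniteGroups.CharacterSymmetricSquare
import Mathlib.LinearAlgebra.PiTensorProduct.Finite
import Mathlib.LinearAlgebra.TensorPower.Basic
import Mathlib.RepresentationTheory.Character
import Mathlib.GroupTheory.Perm.Cycle.Type
import HarnessLib

/-!
# BLMW 2011, (5.2.5): `sk^π_{μμ} ≤ k_{πμμ}` — discharge of `BLMW2011_symKroneckerCoeff_le`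

Sibling proofs file of `BLMW11StabilityInheritance.lean` (val-lit cell, D-0074 GROUP L, row
`BLMW11-A`; P. Bürgisser, J. M. Landsberg, L. Manivel, J. Weyman, SIAM J. Comput. 40 (2011), §5.2,
remark after (5.2.5): "Note that `sk^π_{μμ} ≤ k_{πμμ}` and the inequality may be strict"). The parent
file types it as the named fact `BLMW2011_symKroneckerCoeff_le`:
`symKroneckerCoeff ℂ π μ ≤ kroneckerCoeff ℂ μ μ π`, where
`symKroneckerCoeff ℂ π μ = dim Hom_{𝔖_d}([π], Sym²[μ])` (`Sym²[μ]` = the Schur functor of the one-row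
shape applied to the Specht representation, `symPowerRep (spechtRep ℂ μ) 2`, a subrepresentation of
the diagonal action on `[μ]^{⊗2} = TensorPower ℂ 2 [μ]`) and
`kroneckerCoeff ℂ μ μ π = dim Hom_{𝔖_d}([μ] ⊗ [μ], [π])` (Mathlib's binary `Representation.tprod`).
It is PROVED here (`BLMW2011_symKroneckerCoeff_le_holds`):

1. `Sym²[μ] ⊂ [μ]^{⊗2}` is a subrepresentation, so composing with the inclusion embeds
   `Hom([π], Sym²[μ]) ↪ Hom([π], [μ]^{⊗2})` (`Representation.IntertwiningMap.llcomp`), whence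
   `dim Hom([π], Sym²[μ]) ≤ dim Hom([π], [μ]^{⊗2})`;
2. `[μ]^{⊗2}` (second tensor power with the diagonal action, `tensorDiagRep`) is isomorphic to
   `[μ] ⊗ [μ]` (`Representation.tprod`) — `nonempty_equiv_tprod_tensorDiagRep`, built from Mathlib's
   `TensorPower.mulEquiv` and `PiTensorProduct.subsingletonEquiv`;
3. for the symmetric group every `g` is conjugate to `g⁻¹`, so by the character formula
   `dim Hom_G(V, W) = |G|⁻¹ ∑_g χ_W(g) χ_V(g⁻¹)` (Fulton–Harris (2.9)–(2.11), Cor. 2.16; Mathlib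
   `Representation.card_inv_mul_sum_char_mul_char_eq_finrank`) the dimension of `Hom_G(V, W)` is
   symmetric in `V, W` and invariant under isomorphism (`Representation.char_iso`):
   `dim Hom([π], [μ]^{⊗2}) = dim Hom([μ] ⊗ [μ], [π]) = k_{πμμ}`.

No definitions, no named facts (theorems only). Typed literature; `VP ≠ VNP`
is not proved and nothing here is progress on it.

## Also here: the character formula for `sk^π_{μμ}` (BLMW (5.2.5) evaluated)

* `character_symPowerRep_two`: for any representation `ρ` on `V` (field with `2 ≠ 0`),
  `χ_{Sym²ρ}(g) = ½(χ_ρ(g)² + χ_ρ(g²))` for the Schur-functor rendering `Sym²ρ = symPowerRep ρ 2` —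
  James–Liebeck Prop. 19.14 (tree: `Representation.character_symmSq` on the symmetric tensors
  `S(V ⊗ V)`, `CharacterSymmetricSquare.lean`) transported along `S(V ⊗ V) ≅ c_{(2)} · V^{⊗2}`
  (`c_{(2)} = 1 + (0 1)`, tree `asAlgebraHom_youngSymmetrizer_indiscrete`; the pairing
  `v ⊗ w ↦ v ⊗ w` carries the swap to the transposition and `ρ ⊗ ρ` to the diagonal action);
* `two_mul_card_mul_finrank_intertwiningMap_symPowerRep_two`: `2·|G|·dim Hom_G(τ, Sym²ρ) =
  ∑_g χ_τ(g)(χ_ρ(g)² + χ_ρ(g²))` when every `g` is conjugate to `g⁻¹` (characteristic zero);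
* `two_mul_factorial_mul_symKroneckerCoeff`: **`2 · d! · sk^π_{μμ} = ∑_{τ ∈ 𝔖_d} χ^π(τ)(χ^μ(τ)² + χ^μ(τ²))`**
  — the same right-hand side as the tree's `two_mul_factorial_mul_symKroneckerCoeffRect`
  (`DetOrbitSymKroneckerBound.lean`) for `μ = (d^m)`, so that the bound-space rendering
  `symKroneckerCoeffRect` and BLMW's `symKroneckerCoeff _ (d^m)` agree (drawn in
  `BLMW11InvariantDimensionTransport.lean`).

## References
* [BurgisserEtAl2011] BLMW, SIAM J. Comput. 40 (2011), §5.2 (5.2.5) and the remark after it.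
* [FultonHarrisGTM129] W. Fulton, J. Harris, *Representation Theory*, §2.2 (2.9)–(2.11),
  Cor. 2.16; §2.1 Exercise 2.2; §6.1 (Weyl's construction).
* [JamesLiebeck2001] G. James, M. Liebeck, *Representations and Characters of Groups*, 2nd ed.,
  CUP 2001, Prop. 19.12, 19.14.
-/

noncomputable section

open scoped TensorProduct

namespace Literature.Computability.AlgebraicComplexity

open _root_.Literature.NumberTheory.DiophantineGeometry
open _root_.Literature.RepresentationTheory.GeneralLinear
open _root_.Literature.RepresentationTheory.FiniteGroups

/-! ### The second tensor power as a binary tensor product -/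

section Pair

variable {k G V : Type*} [Field k] [Group G] [AddCommGroup V] [Module k V]

/-- Applying a map entrywise commutes with `Fin.append` (private helper). [folklore] -/
private theorem comp_append {α β : Type*} (f : α → β) {a b : ℕ} (u : Fin a → α) (v : Fin b → α) :
    (fun i => f (Fin.append u v i)) = Fin.append (fun i => f (u i)) (fun i => f (v i)) := by
  funext i
  induction i using Fin.addCases with
  | left j => simp only [Fin.append_left]
  | right j => simp only [Fin.append_right]

/-- **`ρ ⊗ ρ ≅ ρ^{⊗2}` as representations** (private helper): the binary tensor product
representation (`Representation.tprod`) is isomorphic to the diagonal action on the second tensor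
power (`tensorDiagRep ρ 2`), through `v ⊗ w ↦ v ⊗ w` (Mathlib's `TensorPower.mulEquiv` on
`V^{⊗1} ⊗ V^{⊗1}` with `V^{⊗1} ≃ V`, `PiTensorProduct.subsingletonEquiv`). Fulton–Harris §6.1.
[folklore] -/
private theorem nonempty_equiv_tprod_tensorDiagRep (ρ : Representation k G V) :
    Nonempty (Representation.Equiv (ρ.tprod ρ) (tensorDiagRep ρ 2)) := by
  obtain ⟨P, hP⟩ : ∃ P : V ⊗[k] V ≃ₗ[k] TensorPower k 2 V, ∀ v w : V,
      P (v ⊗ₜ w) = PiTensorProduct.tprod k (Fin.append (fun _ : Fin 1 => v) (fun _ : Fin 1 => w)) := by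
    refine ⟨(TensorProduct.congr
        (PiTensorProduct.subsingletonEquiv (R := k) (s := fun _ : Fin 1 => V) 0).symm
        (PiTensorProduct.subsingletonEquiv (R := k) (s := fun _ : Fin 1 => V) 0).symm).trans
      TensorPower.mulEquiv, fun v w => ?_⟩
    simp only [LinearEquiv.trans_apply, TensorProduct.congr_tmul,
      PiTensorProduct.subsingletonEquiv_symm_apply']
    rw [← TensorPower.gMul_def]
    exact TensorPower.tprod_mul_tprod k _ _
  refine ⟨Representation.Equiv.mk P fun g => ?_⟩
  apply TensorProduct.ext'
  intro v w
  rw [LinearMap.comp_apply, LinearMap.comp_apply, Representation.tprod_apply,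
    TensorProduct.map_tmul]
  change P (ρ g v ⊗ₜ[k] ρ g w) = tensorDiagRep ρ 2 g (P (v ⊗ₜ[k] w))
  rw [hP, hP, tensorDiagRep_tprod]
  congr 1
  exact (comp_append (fun x => ρ g x) (fun _ : Fin 1 => v) (fun _ : Fin 1 => w)).symm

end Pair

/-! ### Dimension of `Hom_G(V, W)` is symmetric and isomorphism-invariant when `g ∼ g⁻¹` -/

/-- For a finite group in which every element is conjugate to its inverse and finite-dimensional
representations `α`, `β`, `β'` over a field of characteristic zero with `β' ≅ β`:
`dim Hom_G(α, β) = dim Hom_G(β', α)` — both are `|G|⁻¹ ∑_g χ_α(g) χ_β(g)` (Fulton–Harris (2.9)–(2.11),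
Cor. 2.16; `χ(g⁻¹) = χ(g)`; `χ_β = χ_{β'}`). [cite: FultonHarrisGTM129, §2.2 (2.9)–(2.11) and Cor. 2.16] -/
theorem finrank_intertwiningMap_eq_symm_of_equiv_of_isConj_inv
    {k G A B B' : Type*} [Field k] [CharZero k] [Group G] [Fintype G]
    [AddCommGroup A] [Module k A] [FiniteDimensional k A]
    [AddCommGroup B] [Module k B] [FiniteDimensional k B]
    [AddCommGroup B'] [Module k B'] [FiniteDimensional k B']
    (hG : ∀ g : G, IsConj g g⁻¹) (α : Representation k G A) (β : Representation k G B)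
    (β' : Representation k G B') (e : Representation.Equiv β' β) :
    Module.finrank k (α.IntertwiningMap β) = Module.finrank k (β'.IntertwiningMap α) := by
  haveI : Invertible (Nat.card G : k) :=
    invertibleOfNonzero (Nat.cast_ne_zero.mpr Nat.card_pos.ne')
  apply Nat.cast_injective (R := k)
  rw [← Representation.card_inv_mul_sum_char_mul_char_eq_finrank,
    ← Representation.card_inv_mul_sum_char_mul_char_eq_finrank, Representation.char_iso e]
  congr 1
  refine Finset.sum_congr rfl fun g _ => ?_
  rw [character_inv_of_isConj_inv _ (hG g), character_inv_of_isConj_inv _ (hG g), mul_comm]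

/-! ### The discharge -/

/-- `Hom_G(τ, S_ν(ρ)) ↪ Hom_G(τ, W^{⊗d})`: the dimension of intertwiners into a Schur module
(a subrepresentation of the diagonal action on the tensor power) is at most that into the whole
tensor power. [cite: FultonHarrisGTM129, §6.1 (Weyl's construction)] -/
theorem finrank_intertwiningMap_schurRep_le {k G V U : Type*} [Field k] [Group G]
    [AddCommGroup V] [Module k V] [FiniteDimensional k V]
    [AddCommGroup U] [Module k U] [FiniteDimensional k U]
    (ρ : Representation k G V) (τ : Representation k G U) {d : ℕ} (ν : Nat.Partition d) :
    Module.finrank k (τ.IntertwiningMap (schurRep ρ ν)) ≤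
      Module.finrank k (τ.IntertwiningMap (tensorDiagRep ρ d)) := by
  -- the inclusion `S_ν(ρ) ↪ W^{⊗d}` as an intertwining map
  let ι : (schurRep ρ ν).IntertwiningMap (tensorDiagRep ρ d) :=
    (schurModule k V ν).subtype.intertwiningMap_of_isIntertwiningMap (schurRep ρ ν)
      (tensorDiagRep ρ d) fun g x => coe_schurRep_apply ρ ν g x
  refine LinearMap.finrank_le_finrank_of_injective
    (f := Representation.IntertwiningMap.llcomp τ (schurRep ρ ν) (tensorDiagRep ρ d) ι) ?_
  intro f₁ f₂ h
  apply Representation.IntertwiningMap.ext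
  apply LinearMap.ext
  intro u
  have h' := congrArg (fun F : τ.IntertwiningMap (tensorDiagRep ρ d) => F u) h
  simp only [← Representation.IntertwiningMap.comp_def,
    Representation.IntertwiningMap.comp_apply] at h'
  exact Subtype.val_injective h'

/-- **BLMW 2011, remark after (5.2.5) — the named fact `BLMW2011_symKroneckerCoeff_le` holds:
"Note that `sk^π_{μμ} ≤ k_{πμμ}`"**, i.e. `dim Hom_{𝔖_d}([π], Sym²[μ]) ≤ dim Hom_{𝔖_d}([μ] ⊗ [μ], [π])`
(`Sym²[μ] ⊂ [μ] ⊗ [μ]`). Proof: steps 1–3 of the module docstring.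
[cite: BurgisserEtAl2011, §5.2 (after (5.2.5))] -/
theorem BLMW2011_symKroneckerCoeff_le_holds : BLMW2011_symKroneckerCoeff_le := by
  intro d π μ
  have hG : ∀ g : Equiv.Perm (Fin d), IsConj g g⁻¹ := fun g =>
    Equiv.Perm.isConj_iff_cycleType_eq.mpr (Equiv.Perm.cycleType_inv g).symm
  obtain ⟨e⟩ := nonempty_equiv_tprod_tensorDiagRep (spechtRep ℂ μ)
  have hsymm := @finrank_intertwiningMap_eq_symm_of_equiv_of_isConj_inv ℂ (Equiv.Perm (Fin d))
    (spechtIdeal ℂ π) (TensorPower ℂ 2 (spechtIdeal ℂ μ)) (spechtIdeal ℂ μ ⊗[ℂ] spechtIdeal ℂ μ)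
    _ _ _ _ _ _ _ _ _ _ _ _ _ hG (spechtRep ℂ π) (tensorDiagRep (spechtRep ℂ μ) 2)
    ((spechtRep ℂ μ).tprod (spechtRep ℂ μ)) e
  unfold symKroneckerCoeff kroneckerCoeff symPowerRep
  rw [← hsymm]
  exact finrank_intertwiningMap_schurRep_le (spechtRep ℂ μ) (spechtRep ℂ π)
    (Nat.Partition.indiscrete 2)

/-! ### `Sym²` of the Schur functor is the symmetric square; the character formula for `sk^π_{μμ}` -/

section SymSquare

variable {k G V : Type*} [Field k] [Group G] [AddCommGroup V] [Module k V]

omit [AddCommGroup V] in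
/-- The transposition reverses a pair: `(v, w) ∘ (0 1) = (w, v)` (private helper). [folklore] -/
private theorem append_comp_swap (v w : V) :
    (fun i : Fin 2 => Fin.append (fun _ : Fin 1 => v) (fun _ : Fin 1 => w)
        ((Equiv.swap (0 : Fin 2) 1).symm i)) =
      Fin.append (fun _ : Fin 1 => w) (fun _ : Fin 1 => v) := by
  funext i
  fin_cases i <;> rfl

/-- `∑_{τ ∈ 𝔖_2} f τ = f 1 + f (0 1)` (private helper). [folklore] -/
private theorem sum_perm_fin_two {M : Type*} [AddCommMonoid M] (f : Equiv.Perm (Fin 2) → M) :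
    ∑ τ, f τ = f 1 + f (Equiv.swap 0 1) := by
  have h : (Finset.univ : Finset (Equiv.Perm (Fin 2))) = {1, Equiv.swap 0 1} := by decide
  rw [h, Finset.sum_pair (by decide)]

/-- **`Sym²` via the Schur functor is the symmetric square** (private): for any representation `ρ`
on `V` (over a field with `2 ≠ 0`), the one-row Schur functor `symPowerRep ρ 2 = S_{(2)}(ρ)` on
`c_{(2)} · V^{⊗2} = (1 + (0 1)) · V^{⊗2}` is isomorphic to `Representation.symmSq ρ` on the symmetric
tensors `S(V ⊗ V) = {x : xT = x}` (James–Liebeck Prop. 19.12), through `v ⊗ w ↦ v ⊗ w`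
(`TensorPower.mulEquiv`), which carries the swap `T` to the transposition `(0 1)` and `ρ ⊗ ρ` to the
diagonal action. Fulton–Harris §6.1 (`S_{(d)}V = Sym^d V`). [folklore] -/
private theorem nonempty_equiv_symmSq_symPowerRep [NeZero (2 : k)] (ρ : Representation k G V) :
    Nonempty (Representation.Equiv ρ.symmSq (symPowerRep ρ 2)) := by
  classical
  -- the pairing `P : V ⊗ V ≃ V^{⊗2}`, `v ⊗ w ↦ v ⊗ w`
  obtain ⟨P, hP⟩ : ∃ P : V ⊗[k] V ≃ₗ[k] TensorPower k 2 V, ∀ v w : V,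
      P (v ⊗ₜ w) = PiTensorProduct.tprod k (Fin.append (fun _ : Fin 1 => v) (fun _ : Fin 1 => w)) := by
    refine ⟨(TensorProduct.congr
        (PiTensorProduct.subsingletonEquiv (R := k) (s := fun _ : Fin 1 => V) 0).symm
        (PiTensorProduct.subsingletonEquiv (R := k) (s := fun _ : Fin 1 => V) 0).symm).trans
      TensorPower.mulEquiv, fun v w => ?_⟩
    simp only [LinearEquiv.trans_apply, TensorProduct.congr_tmul,
      PiTensorProduct.subsingletonEquiv_symm_apply']
    rw [← TensorPower.gMul_def]
    exact TensorPower.tprod_mul_tprod k _ _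
  -- `P` carries the swap `T` to the transposition `(0 1)`
  have hswap : ∀ x : V ⊗[k] V,
      P (TensorProduct.comm k V V x) = permTensorRep k V 2 (Equiv.swap 0 1) (P x) := by
    intro x
    induction x using TensorProduct.induction_on with
    | zero => simp only [map_zero]
    | tmul v w =>
      rw [TensorProduct.comm_tmul, hP, hP, permTensorRep_tprod, append_comp_swap]
    | add x y hx hy => rw [map_add, map_add, hx, hy, ← map_add, ← map_add]
  -- `P` carries `ρ(g) ⊗ ρ(g)` to the diagonal action
  have hdiag : ∀ (g : G) (x : V ⊗[k] V),
      P (TensorProduct.map (ρ g) (ρ g) x) = tensorDiagRep ρ 2 g (P x) := by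
    intro g x
    induction x using TensorProduct.induction_on with
    | zero => simp only [map_zero]
    | tmul v w =>
      rw [TensorProduct.map_tmul, hP, hP, tensorDiagRep_tprod]
      congr 1
      exact (comp_append (fun x => ρ g x) _ _).symm
    | add x y hx hy => rw [map_add, map_add, hx, hy, ← map_add, ← map_add]
  -- `c_{(2)}` acts as `1 + (0 1)`
  have hc : (permTensorRep k V 2).asAlgebraHom (youngSymmetrizer k (Nat.Partition.indiscrete 2)) =
      LinearMap.id + permTensorRep k V 2 (Equiv.swap 0 1) := by
    rw [asAlgebraHom_youngSymmetrizer_indiscrete, symmetrizeT, sum_perm_fin_two, map_one]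
    rfl
  -- `P(S(V ⊗ V)) = c_{(2)} · V^{⊗2}`
  have hmap : (symmetricTensors k V).map (P : V ⊗[k] V →ₗ[k] TensorPower k 2 V) =
      schurModule k V (Nat.Partition.indiscrete 2) := by
    apply le_antisymm
    · rintro _ ⟨x, hx, rfl⟩
      rw [SetLike.mem_coe, mem_symmetricTensors_iff] at hx
      refine ⟨(2 : k)⁻¹ • P x, ?_⟩
      rw [hc, map_smul, LinearMap.add_apply, LinearMap.id_apply, ← hswap, hx, ← two_smul k,
        smul_smul, inv_mul_cancel₀ (NeZero.ne 2), one_smul, LinearEquiv.coe_coe]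
    · rintro _ ⟨y, rfl⟩
      refine ⟨P.symm y + TensorProduct.comm k V V (P.symm y),
        add_comm_apply_mem_symmetricTensors _, ?_⟩
      rw [LinearEquiv.coe_coe, map_add, hswap, LinearEquiv.apply_symm_apply, hc,
        LinearMap.add_apply, LinearMap.id_apply]
  -- the equivalence
  refine ⟨Representation.Equiv.mk ((P.submoduleMap _).trans (LinearEquiv.ofEq _ _ hmap)) fun g => ?_⟩
  apply LinearMap.ext
  intro x
  apply Subtype.ext
  change ((((P.submoduleMap _).trans (LinearEquiv.ofEq _ _ hmap)) (ρ.symmSq g x) :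
      schurModule k V (Nat.Partition.indiscrete 2)) : TensorPower k 2 V) =
    ((symPowerRep ρ 2 g (((P.submoduleMap _).trans (LinearEquiv.ofEq _ _ hmap)) x) :
      schurModule k V (Nat.Partition.indiscrete 2)) : TensorPower k 2 V)
  rw [LinearEquiv.trans_apply, LinearEquiv.coe_ofEq_apply, LinearEquiv.submoduleMap_apply,
    Representation.symmSq_apply_coe, hdiag, coe_schurRep_apply, LinearEquiv.trans_apply,
    LinearEquiv.coe_ofEq_apply, LinearEquiv.submoduleMap_apply]

/-- **The character of `Sym²(ρ) = S_{(2)}(ρ)`**: `χ_{Sym²ρ}(g) = ½ (χ_ρ(g)² + χ_ρ(g²))`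
(James–Liebeck Prop. 19.14 for the symmetric square, transported to the Schur-functor rendering
`symPowerRep ρ 2` of `SchurFunctor.lean` by `nonempty_equiv_symmSq_symPowerRep`).
[cite: JamesLiebeck2001, Prop. 19.14] [cite: FultonHarrisGTM129, §2.1 Exercise 2.2] -/
theorem character_symPowerRep_two [NeZero (2 : k)] [FiniteDimensional k V]
    (ρ : Representation k G V) (g : G) :
    (symPowerRep ρ 2).character g = (2 : k)⁻¹ * (ρ.character g ^ 2 + ρ.character (g ^ 2)) := by
  obtain ⟨e⟩ := nonempty_equiv_symmSq_symPowerRep ρ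
  rw [← Representation.char_iso e, Representation.character_symmSq]

/-- **`2 · |G| · dim Hom_G(τ, Sym²ρ) = ∑_g χ_τ(g) (χ_ρ(g)² + χ_ρ(g²))`** for a finite group in which
every element is conjugate to its inverse (e.g. `𝔖_d`), over a field of characteristic zero:
`dim Hom_G(τ, Sym²ρ) = |G|⁻¹ ∑_g χ_{Sym²ρ}(g) χ_τ(g⁻¹)` (Fulton–Harris (2.9)–(2.11), Cor. 2.16; Mathlib
`Representation.card_inv_mul_sum_char_mul_char_eq_finrank`), `χ_τ(g⁻¹) = χ_τ(g)`
(`character_inv_of_isConj_inv`) and `χ_{Sym²ρ}(g) = ½(χ_ρ(g)² + χ_ρ(g²))` (`character_symPowerRep_two`).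
Stated for an arbitrary module `V` (instantiated below with the Specht module).
[cite: FultonHarrisGTM129, §2.2 (2.9)–(2.11) and Cor. 2.16] -/
theorem two_mul_card_mul_finrank_intertwiningMap_symPowerRep_two {U : Type*} [CharZero k] [Fintype G]
    [FiniteDimensional k V] [AddCommGroup U] [Module k U] [FiniteDimensional k U]
    (hG : ∀ g : G, IsConj g g⁻¹) (ρ : Representation k G V) (τ : Representation k G U) :
    ((2 * Fintype.card G * Module.finrank k (τ.IntertwiningMap (symPowerRep ρ 2)) : ℕ) : k) =
      ∑ g : G, τ.character g * (ρ.character g ^ 2 + ρ.character (g * g)) := by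
  classical
  haveI : Invertible (Nat.card G : k) :=
    invertibleOfNonzero (Nat.cast_ne_zero.mpr Nat.card_pos.ne')
  have h := Representation.card_inv_mul_sum_char_mul_char_eq_finrank
    (W := ↥(schurModule k V (Nat.Partition.indiscrete 2))) τ (symPowerRep ρ 2)
  have hc : ((Fintype.card G : ℕ) : k) ≠ 0 := Nat.cast_ne_zero.mpr Fintype.card_ne_zero
  rw [Nat.cast_mul, Nat.cast_mul, ← h, Nat.card_eq_fintype_card, mul_assoc,
    ← mul_assoc ((Fintype.card G : ℕ) : k), mul_inv_cancel₀ hc, one_mul, Finset.mul_sum]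
  refine Finset.sum_congr rfl fun g _ => ?_
  rw [character_symPowerRep_two, character_inv_of_isConj_inv _ (hG g), pow_two g, Nat.cast_two,
    ← mul_assoc, ← mul_assoc, mul_inv_cancel₀ (two_ne_zero' k), one_mul, mul_comm]

end SymSquare

/-- **Character formula for the symmetric Kronecker coefficient (BLMW 2011 (5.2.5))** over a field of
characteristic zero: `2 · d! · sk^π_{μμ} = ∑_{τ ∈ 𝔖_d} χ^π(τ) (χ^μ(τ)² + χ^μ(τ²))`
(`sk^π_{μμ} = dim Hom_{𝔖_d}([π], Sym²[μ])`; `two_mul_card_mul_finrank_intertwiningMap_symPowerRep_two` for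
the Specht modules, every permutation being conjugate to its inverse). Same right-hand side as the
tree's `two_mul_factorial_mul_symKroneckerCoeffRect` for the rectangle `μ = (d^m)`
(`DetOrbitSymKroneckerBound.lean`), which therefore agrees with `symKroneckerCoeff` there.
[cite: BurgisserEtAl2011, §5.2 (5.2.5)] [cite: FultonHarrisGTM129, §2.2 (2.9)–(2.11) and Cor. 2.16] -/
theorem two_mul_factorial_mul_symKroneckerCoeff (k : Type*) [Field k] [CharZero k] {d : ℕ}
    (π μ : Nat.Partition d) :
    ((2 * d.factorial * symKroneckerCoeff k π μ : ℕ) : k) =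
      ∑ τ : Equiv.Perm (Fin d), spechtCharacter k π τ *
        (spechtCharacter k μ τ ^ 2 + spechtCharacter k μ (τ * τ)) := by
  have hG : ∀ g : Equiv.Perm (Fin d), IsConj g g⁻¹ := fun g =>
    Equiv.Perm.isConj_iff_cycleType_eq.mpr (Equiv.Perm.cycleType_inv g).symm
  have h := two_mul_card_mul_finrank_intertwiningMap_symPowerRep_two hG (spechtRep k μ) (spechtRep k π)
  rw [Fintype.card_perm, Fintype.card_fin] at h
  unfold symKroneckerCoeff
  rw [h]

end Literature.Computability.AlgebraicComplexity
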